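import Literature.MeasureTheory.Group.InvariantQuotientPiTopFactorMap   -- ★ p850236 (LH3-p03 (g3)): the `A × B` package; brings ★ PiNormalized ∕ Transport and the change-of-variables corollaries' patterns
import HarnessLib

/-!
# `A ⧸ M ≃ₜ Π_i (G_i ⧸ M_i)` for a subgroup `M ↔ Π_i M_i` along `A ≃ₜ* Π_i G_i`, and the quotient measure IS the product of the local quotient measures
(Folland, *A Course in Abstract Harmonic Analysis* (1995), §2.6 Thm. 2.49, (2.52); Deitmar–Echterhoff (2014), Thm. 1.5.3; Gelbart (1975), §10 (10.19))

Topic `MeasureTheory/Group`; namespace `Literature.MeasureTheory.Group`; THEOREMS ONLY (no definition, no instance visible to importers, no named fact, no `sorry`).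
The `B`-FREE form of ★ `exists_haar_homeomorph_map_quotientMeasure_prod_pi_top` (`InvariantQuotientPiTopFactorMap`): a locally compact group `A` with a place
decomposition `eA : A ≃ₜ* Π_i G_i`, a closed subgroup `M ≤ A` that is PLACEWISE — `a ∈ M ↔ ∀ i, (eA a)_i ∈ M_i` — product Haar measure `νA = eA⁻¹_* ⊗_i ν_i` and
Haar measures `ρ_i` on the closed `M_i`.  Then (`exists_haar_homeomorph_map_quotientMeasure_pi`) there are ONE inversion-invariant Haar measure `ρ` on `M` and ONE
homeomorphism `Ψ : A ⧸ M ≃ₜ Π_i (G_i ⧸ M_i)`, `Ψ(a M) = ((eA a)_i M_i)_i`, with (mass) `ρ {m | ∀ i, (eA m)_i ∈ K_i} = Π_i ρ_i(K_i)` and **`Ψ_* (νA ∕ ρ) = ⊗_i (ν_i ∕ ρ_i)`**;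
corollaries: change of variables `integral_quotientMeasure_eq_integral_pi_of_map_eq'` (Bochner, no integrability hypothesis), `integrable_quotientMeasure_iff_of_map_eq'`,
the orbital integrand in coordinates `descConj_homeomorph_symm_eq'` and the PRODUCT form `integral_descConj_quotientMeasure_eq_prod_of_map_eq'`
(`F(a) = Π_i f_i((eA a)_i)` ⟹ `∫_{A⧸M} F(yγy⁻¹) d(νA∕ρ) = Π_i ∫_{G_i⧸M_i} f_i(xγ_ix⁻¹) d(ν_i∕ρ_i)`, Gelbart's (10.19) with its equality sign).  The situation of a SINGLE
archimedean unitary group `G′_∞ = U(H)(L⁺ ⊗ ℝ) ≃ Π_w U(σ_w H)(ℂ)` modulo a placewise Cartan (the `G′`-side chart functional ★ `chartOrbG` of the hodgecm line LH3, crux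
`stmt-HodgeConjecture-24833`).
HONEST LABEL: pure measure theory; HC_CM is proved only modulo the printed citations until rung 0 closes and this file pays nothing by itself.

## References
* [Folland1995] G. B. Folland, *A Course in Abstract Harmonic Analysis* (1995), §2.2, §2.6 Thm. 2.49, (2.52).
* [DeitmarEchterhoff2014] A. Deitmar, S. Echterhoff, *Principles of Harmonic Analysis*, 2nd ed. (2014), Thm. 1.5.3.
* [Gelbart1975] S. Gelbart, *Automorphic forms on adele groups*, Ann. of Math. Studies 83 (1975), §10, p. 155, (10.19).
* [BorelJacquet1979] A. Borel, H. Jacquet, *Automorphic forms and automorphic representations*, PSPM 33.1 (1979), §4.1.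
-/

set_option autoImplicit false

noncomputable section

open MeasureTheory MeasureTheory.Measure Topology
open scoped NNReal ENNReal

namespace Literature.MeasureTheory.Group

section Helpers

variable {G G' : Type*} [Group G] [Group G'] [TopologicalSpace G] [TopologicalSpace G']
  [IsTopologicalGroup G] [IsTopologicalGroup G'] [MeasurableSpace G] [BorelSpace G] [MeasurableSpace G'] [BorelSpace G']
  (e : G ≃* G') (he : Continuous e) (hes : Continuous e.symm)
  (H : Subgroup G) (H' : Subgroup G') (hHH' : ∀ g, e g ∈ H' ↔ g ∈ H)

/-- Transported Haar measures along `subgroupCongrHomeomorph` are Haar. [folklore] -/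
private theorem isHaarMeasure_map_subgroupCongrHomeomorph₃ [LocallyCompactSpace H] (ρ : Measure H) [IsHaarMeasure ρ] :
    IsHaarMeasure (Measure.map (subgroupCongrHomeomorph e H H' hHH' he hes) ρ) := by
  let f : H ≃* H' :=
    { toFun := fun h => ⟨e h, (hHH' h).2 h.2⟩
      invFun := fun h' => ⟨e.symm h', (forall_symm_mem_iff e H H' hHH' h').2 h'.2⟩
      left_inv := fun h => Subtype.ext (e.symm_apply_apply h)
      right_inv := fun h' => Subtype.ext (e.apply_symm_apply h')
      map_mul' := fun a b => Subtype.ext (by simp only [Subgroup.coe_mul, map_mul]) }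
  have hf : ⇑f = ⇑(subgroupCongrHomeomorph e H H' hHH' he hes) := rfl
  have h := MulEquiv.isHaarMeasure_map ρ f (hf ▸ (subgroupCongrHomeomorph e H H' hHH' he hes).continuous)
    (by
      have : ⇑f.symm = ⇑(subgroupCongrHomeomorph e H H' hHH' he hes).symm := rfl
      rw [this]; exact (subgroupCongrHomeomorph e H H' hHH' he hes).symm.continuous)
  rwa [hf] at h

/-- … and inversion invariant. [folklore] -/
private theorem isInvInvariant_map_subgroupCongrHomeomorph₃ (ρ : Measure H) [ρ.IsInvInvariant] :
    (Measure.map (subgroupCongrHomeomorph e H H' hHH' he hes) ρ).IsInvInvariant := by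
  let f : H ≃* H' :=
    { toFun := fun h => ⟨e h, (hHH' h).2 h.2⟩
      invFun := fun h' => ⟨e.symm h', (forall_symm_mem_iff e H H' hHH' h').2 h'.2⟩
      left_inv := fun h => Subtype.ext (e.symm_apply_apply h)
      right_inv := fun h' => Subtype.ext (e.apply_symm_apply h')
      map_mul' := fun a b => Subtype.ext (by simp only [Subgroup.coe_mul, map_mul]) }
  have hf : ⇑f = ⇑(subgroupCongrHomeomorph e H H' hHH' he hes) := rfl
  have h := isInvInvariant_map_mulEquiv f (hf ▸ (subgroupCongrHomeomorph e H H' hHH' he hes).continuous.measurable) ρ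
  rwa [hf] at h

end Helpers

/-! ### The package -/

section PiMap

variable {ι : Type*} [Fintype ι]
  {Gi : ι → Type*} [∀ i, Group (Gi i)] [∀ i, TopologicalSpace (Gi i)] [∀ i, IsTopologicalGroup (Gi i)]
  [∀ i, LocallyCompactSpace (Gi i)] [∀ i, SecondCountableTopology (Gi i)] [∀ i, T2Space (Gi i)]
  [∀ i, MeasurableSpace (Gi i)] [∀ i, BorelSpace (Gi i)]
  {A : Type*} [Group A] [TopologicalSpace A] [IsTopologicalGroup A] [LocallyCompactSpace A] [SecondCountableTopology A] [T2Space A]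
  [MeasurableSpace A] [BorelSpace A]
  (eA : A ≃ₜ* (∀ i, Gi i))
  (Mi : ∀ i, Subgroup (Gi i)) (hMi : ∀ i, IsClosed (Mi i : Set (Gi i)))
  (M : Subgroup A) (hM : IsClosed (M : Set A))
  (hmem : ∀ a : A, a ∈ M ↔ ∀ i, eA a i ∈ Mi i)
  (ρi : ∀ i, Measure (Mi i)) [∀ i, (ρi i).IsHaarMeasure] [∀ i, (ρi i).IsInvInvariant] [∀ i, SigmaFinite (ρi i)]
  (νi : ∀ i, Measure (Gi i)) [∀ i, IsHaarMeasure (νi i)] [∀ i, (νi i).IsMulRightInvariant]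
  (νA : Measure A) [IsHaarMeasure νA] [νA.IsMulRightInvariant]
  (hν : νA = (Measure.pi νi).map eA.symm)
  [MeasurableSpace (A ⧸ M)] [BorelSpace (A ⧸ M)]
  [∀ i, MeasurableSpace (Gi i ⧸ Mi i)] [∀ i, BorelSpace (Gi i ⧸ Mi i)]

include hMi hmem hν in
/-- **THE `B`-FREE PACKAGE AT THE LEVEL OF MEASURES.**  `eA : A ≃ₜ* Π_i G_i`, `M ≤ A` closed and placewise (`a ∈ M ↔ ∀ i, (eA a)_i ∈ M_i`), product Haar
`νA = eA⁻¹_* ⊗ ν_i`, Haar `ρ_i` on the `M_i` ⟹ ONE inversion-invariant Haar `ρ` on `M` and ONE homeomorphism `Ψ : A ⧸ M ≃ₜ Π_i (G_i ⧸ M_i)`, `Ψ(aM) = ((eA a)_i M_i)_i`,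
with (mass) `ρ {m | ∀ i, (eA m)_i ∈ K_i} = Π_i ρ_i K_i` and **`Ψ_* (νA ∕ ρ) = ⊗_i (ν_i ∕ ρ_i)`** (★ `map_cosetCongr_quotientMeasure` + ★ `map_quotientPiHomeomorph_quotientMeasure_pi`,
constant `1`). [cite: Folland1995, §2.6 Thm. 2.49, (2.52)] [cite: DeitmarEchterhoff2014, Thm. 1.5.3] [cite: Gelbart1975, p. 155 (10.19)] [cite: BorelJacquet1979, §4.1] -/
theorem exists_haar_homeomorph_map_quotientMeasure_pi :
    ∃ (ρ : Measure M) (_ : ρ.IsHaarMeasure) (_ : ρ.IsInvInvariant) (Ψ : A ⧸ M ≃ₜ (∀ i, Gi i ⧸ Mi i)),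
      (∀ K : ∀ i, Set (Mi i), ρ {m : M | ∀ i, (⟨eA (m : A) i, (hmem _).1 m.2 i⟩ : Mi i) ∈ K i} = ∏ i, ρi i (K i)) ∧
      (∀ a : A, Ψ (QuotientGroup.mk a) = fun i => (QuotientGroup.mk (eA a i) : Gi i ⧸ Mi i)) ∧
      (∀ x : ∀ i, Gi i, Ψ.symm (fun i => (QuotientGroup.mk (x i) : Gi i ⧸ Mi i)) = QuotientGroup.mk (eA.symm x)) ∧
      Measure.map Ψ (quotientMeasure M ρ hM νA) = Measure.pi fun i => quotientMeasure (Mi i) (ρi i) (hMi i) (νi i) := by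
  classical
  haveI : ∀ i, LocallyCompactSpace (Mi i) := fun i => (hMi i).isClosedEmbedding_subtypeVal.locallyCompactSpace
  haveI hMc : IsClosed (M : Set A) := hM
  haveI : LocallyCompactSpace M := hM.isClosedEmbedding_subtypeVal.locallyCompactSpace
  haveI : ∀ i, IsClosed (Mi i : Set (Gi i)) := hMi
  -- `e = eA⁻¹ : Π G_i ≃* A`, `M' = Π M_i`
  set e : (∀ i, Gi i) ≃* A := eA.symm.toMulEquiv with he_def
  have he_apply : ∀ x : ∀ i, Gi i, e x = eA.symm x := fun x => rfl
  have he : Continuous e := eA.symm.continuous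
  have hes : Continuous e.symm := eA.continuous
  have hπc : IsClosed ((Subgroup.pi Set.univ Mi : Subgroup (∀ i, Gi i)) : Set (∀ i, Gi i)) := isClosed_coe_pi Mi hMi
  haveI : IsClosed ((Subgroup.pi Set.univ Mi : Subgroup (∀ i, Gi i)) : Set (∀ i, Gi i)) := hπc
  have hHH' : ∀ x : ∀ i, Gi i, e x ∈ M ↔ x ∈ Subgroup.pi Set.univ Mi := fun x => by
    rw [hmem, he_apply, Subgroup.mem_pi]
    simp only [ContinuousMulEquiv.apply_symm_apply, Set.mem_univ, forall_const]
  letI : MeasurableSpace ((∀ i, Gi i) ⧸ Subgroup.pi Set.univ Mi) := borel _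
  haveI : BorelSpace ((∀ i, Gi i) ⧸ Subgroup.pi Set.univ Mi) := ⟨rfl⟩
  -- the product torus measure on `Π M_i`
  let eπ : (Subgroup.pi Set.univ Mi) ≃ₜ* (∀ i, Mi i) :=
    { subgroupPiCoords Mi with
      continuous_toFun := (subgroupPiHomeomorph Mi).continuous
      continuous_invFun := (subgroupPiHomeomorph Mi).symm.continuous }
  have heπ : (⇑eπ : (Subgroup.pi Set.univ Mi) → ∀ i, Mi i) = subgroupPiCoords Mi := rfl
  set ρπ : Measure (Subgroup.pi Set.univ Mi) := (Measure.pi ρi).map eπ.symm with hρπ_def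
  haveI : LocallyCompactSpace (Subgroup.pi Set.univ Mi) := hπc.isClosedEmbedding_subtypeVal.locallyCompactSpace
  haveI : ρπ.IsHaarMeasure := eπ.symm.isHaarMeasure_map _
  haveI : ρπ.IsInvInvariant := isInvInvariant_map_mulEquiv eπ.symm.toMulEquiv eπ.symm.continuous.measurable _
  have hρπ : Measure.map (subgroupPiCoords Mi) ρπ = Measure.pi ρi := by
    rw [hρπ_def, ← heπ, Measure.map_map (show Measurable (⇑eπ : (Subgroup.pi Set.univ Mi) → ∀ i, Mi i) from eπ.continuous.measurable)
      (show Measurable (⇑eπ.symm : (∀ i, Mi i) → (Subgroup.pi Set.univ Mi)) from eπ.symm.continuous.measurable)]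
    have : (⇑eπ : (Subgroup.pi Set.univ Mi) → ∀ i, Mi i) ∘ ⇑eπ.symm = id := funext fun x => eπ.apply_symm_apply x
    rw [this, Measure.map_id]
  -- `ρ` on `M`
  set ρ : Measure M := ρπ.map (subgroupCongrHomeomorph e _ M hHH' he hes) with hρ_def
  haveI hρH : ρ.IsHaarMeasure := isHaarMeasure_map_subgroupCongrHomeomorph₃ e he hes _ M hHH' ρπ
  haveI hρI : ρ.IsInvInvariant := isInvInvariant_map_subgroupCongrHomeomorph₃ e he hes _ M hHH' ρπ
  have hν' : νA = Measure.map e (Measure.pi νi) := by rw [hν]; rfl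
  have hT := map_cosetCongr_quotientMeasure e he hes (Subgroup.pi Set.univ Mi) M hHH' ρπ ρ (Measure.pi νi) νA rfl hν'
  -- `Ψ`
  let Ψ : A ⧸ M ≃ₜ (∀ i, Gi i ⧸ Mi i) := (cosetCongrHomeomorph e _ M hHH' he hes).symm.trans (quotientPiHomeomorph Mi)
  have hΨ : ∀ a : A, Ψ (QuotientGroup.mk a) = fun i => (QuotientGroup.mk (eA a i) : Gi i ⧸ Mi i) := by
    intro a
    simp only [Ψ, Homeomorph.trans_apply]
    have h1 : (cosetCongrHomeomorph e _ M hHH' he hes).symm (QuotientGroup.mk a) = QuotientGroup.mk (e.symm a) := rfl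
    rw [h1, coe_quotientPiHomeomorph, quotientPiEquiv_mk]
    rfl
  have hΨsymm : ∀ x : ∀ i, Gi i, Ψ.symm (fun i => (QuotientGroup.mk (x i) : Gi i ⧸ Mi i)) = QuotientGroup.mk (eA.symm x) := by
    intro x
    rw [Homeomorph.symm_apply_eq, hΨ]
    simp only [ContinuousMulEquiv.apply_symm_apply]
  have hmap : Measure.map Ψ (quotientMeasure M ρ hM νA) = Measure.pi fun i => quotientMeasure (Mi i) (ρi i) (hMi i) (νi i) := by
    have h1 : Measure.map (cosetCongrHomeomorph e _ M hHH' he hes).symm (quotientMeasure M ρ hM νA) =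
        quotientMeasure (Subgroup.pi Set.univ Mi) ρπ hπc (Measure.pi νi) := by
      rw [← hT, ← coe_cosetCongrHomeomorph e _ M hHH' he hes,
        Measure.map_map (cosetCongrHomeomorph e _ M hHH' he hes).symm.measurable (cosetCongrHomeomorph e _ M hHH' he hes).measurable,
        Homeomorph.symm_comp_self, Measure.map_id]
    have h2 := map_quotientPiHomeomorph_quotientMeasure_pi Mi hMi ρi ρπ hρπ νi
    have hΨfun : (⇑Ψ : A ⧸ M → ∀ i, Gi i ⧸ Mi i) = (⇑(quotientPiHomeomorph Mi)) ∘ (⇑(cosetCongrHomeomorph e _ M hHH' he hes).symm) := rfl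
    rw [hΨfun, ← Measure.map_map (quotientPiHomeomorph Mi).measurable (cosetCongrHomeomorph e _ M hHH' he hes).symm.measurable, h1, h2]
  refine ⟨ρ, hρH, hρI, Ψ, ?_, hΨ, hΨsymm, hmap⟩
  -- (mass)
  intro K
  rw [hρ_def, ← Homeomorph.toMeasurableEquiv_coe, MeasurableEquiv.map_apply, hρπ_def,
    show Measure.map (⇑eπ.symm) (Measure.pi ρi) = Measure.map (⇑eπ.symm.toHomeomorph.toMeasurableEquiv) (Measure.pi ρi) from rfl, MeasurableEquiv.map_apply,
    ← Measure.pi_pi]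
  congr 1
  ext y
  simp only [Set.mem_preimage, Set.mem_setOf_eq, Set.mem_pi, Set.mem_univ, forall_const, Homeomorph.toMeasurableEquiv_coe]
  refine forall_congr' fun i => ?_
  have hy : eA ((subgroupCongrHomeomorph e _ M hHH' he hes (eπ.symm.toHomeomorph y) : M) : A) i = ((y i : Mi i) : Gi i) := by
    rw [coe_subgroupCongrHomeomorph_apply, he_apply, ContinuousMulEquiv.apply_symm_apply]
    rfl
  exact ⟨fun h => by convert h using 1; exact Subtype.ext hy.symm, fun h => by convert h using 1; exact Subtype.ext hy⟩

/-! ### Consequences for ANY (`ρ`, `Ψ`) satisfying the identities -/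

variable (ρ : Measure M) [ρ.IsHaarMeasure] [ρ.IsInvInvariant] (Ψ : A ⧸ M ≃ₜ (∀ i, Gi i ⧸ Mi i))
  (hmap : Measure.map Ψ (quotientMeasure M ρ hM νA) = Measure.pi fun i => quotientMeasure (Mi i) (ρi i) (hMi i) (νi i))

include hmap in
omit [∀ i, SigmaFinite (ρi i)] in
/-- **Change of variables along `Ψ`** (Bochner, no integrability hypothesis). [cite: Folland1995, §2.6 (2.52)] -/
theorem integral_quotientMeasure_eq_integral_pi_of_map_eq' {E : Type*} [NormedAddCommGroup E] [NormedSpace ℝ E] (F : A ⧸ M → E) :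
    ∫ y, F y ∂(quotientMeasure M ρ hM νA) = ∫ p, F (Ψ.symm p) ∂(Measure.pi fun i => quotientMeasure (Mi i) (ρi i) (hMi i) (νi i)) := by
  rw [← hmap, ← Homeomorph.toMeasurableEquiv_coe, integral_map_equiv]
  simp only [Homeomorph.toMeasurableEquiv_coe, Homeomorph.symm_apply_apply]

include hmap in
omit [∀ i, SigmaFinite (ρi i)] in
/-- **Integrability transfers along `Ψ`.** [cite: Folland1995, §2.6 (2.52)] -/
theorem integrable_quotientMeasure_iff_of_map_eq' {E : Type*} [NormedAddCommGroup E] (F : A ⧸ M → E) :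
    Integrable F (quotientMeasure M ρ hM νA) ↔ Integrable (fun p => F (Ψ.symm p)) (Measure.pi fun i => quotientMeasure (Mi i) (ρi i) (hMi i) (νi i)) := by
  rw [← hmap]
  have h := integrable_map_equiv (μ := quotientMeasure M ρ hM νA) Ψ.toMeasurableEquiv (fun p => F (Ψ.symm p))
  rw [Homeomorph.toMeasurableEquiv_coe] at h
  rw [h]
  simp only [Function.comp_def, Homeomorph.symm_apply_apply]

include hmap in
omit [∀ i, SigmaFinite (ρi i)] in
/-- **PRODUCT TEST FUNCTIONS FACTOR EXACTLY** (Gelbart's (10.19) with its equality sign, placewise subgroup): if `Ψ⁻¹((x_i M_i)_i) = (eA⁻¹ x) M`, `γ = eA⁻¹ γ_•` commutes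
with `M` and `F(a) = Π_i f_i((eA a)_i)`, then `∫_{A⧸M} F(yγy⁻¹) d(νA∕ρ) = Π_i ∫_{G_i⧸M_i} f_i(xγ_ix⁻¹) d(ν_i∕ρ_i)`. [cite: Gelbart1975, p. 155 (10.19)] [cite: Folland1995, §2.6 (2.52)] -/
theorem integral_descConj_quotientMeasure_eq_prod_of_map_eq'
    (hΨsymm : ∀ x : ∀ i, Gi i, Ψ.symm (fun i => (QuotientGroup.mk (x i) : Gi i ⧸ Mi i)) = QuotientGroup.mk (eA.symm x))
    (γi : ∀ i, Gi i) (hγi : ∀ i, ∀ m ∈ Mi i, m * γi i = γi i * m) (hγ : ∀ m ∈ M, m * eA.symm γi = eA.symm γi * m)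
    (F : A → ℂ) (f : ∀ i, Gi i → ℂ) (hF : ∀ a, F a = ∏ i, f i (eA a i)) :
    ∫ y, descConj (eA.symm γi) M hγ F y ∂(quotientMeasure M ρ hM νA) =
      ∏ i, ∫ x, descConj (γi i) (Mi i) (hγi i) (f i) x ∂(quotientMeasure (Mi i) (ρi i) (hMi i) (νi i)) := by
  haveI : ∀ i, IsClosed (Mi i : Set (Gi i)) := hMi
  haveI : ∀ i, SigmaFinite (quotientMeasure (Mi i) (ρi i) (hMi i) (νi i)) := fun i => inferInstance
  rw [integral_quotientMeasure_eq_integral_pi_of_map_eq' Mi hMi M hM ρi νi νA ρ Ψ hmap, ← integral_fintype_prod_eq_prod]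
  refine integral_congr_ae (Filter.Eventually.of_forall fun p => ?_)
  have hp : p = fun i => (QuotientGroup.mk (p i).out : Gi i ⧸ Mi i) := funext fun i => (QuotientGroup.out_eq' (p i)).symm
  simp only []
  rw [hp, hΨsymm, descConj_mk, ← map_inv, ← map_mul, ← map_mul, hF, ContinuousMulEquiv.apply_symm_apply]
  refine Finset.prod_congr rfl fun i _ => ?_
  rw [descConj_mk]
  rfl

end PiMap

/-! ### The orbital integrand in the coordinates `Ψ` -/

section Coord

variable {ι : Type*} {Gi : ι → Type*} [∀ i, Group (Gi i)] [∀ i, TopologicalSpace (Gi i)]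
  {A : Type*} [Group A] [TopologicalSpace A] (eA : A ≃ₜ* (∀ i, Gi i)) (Mi : ∀ i, Subgroup (Gi i)) (M : Subgroup A) (Ψ : A ⧸ M ≃ₜ (∀ i, Gi i ⧸ Mi i))

/-- **The orbital integrand in the coordinates `Ψ`** (`B`-free): `(y ↦ F(yγy⁻¹))(Ψ⁻¹ p) = F(eA⁻¹ (x_i γ_i x_i⁻¹)_i)`, `x_i` any representatives of `p_i`.
[cite: Gelbart1975, p. 155 (10.19)] -/
theorem descConj_homeomorph_symm_eq' {α : Type*}
    (hΨsymm : ∀ x : ∀ i, Gi i, Ψ.symm (fun i => (QuotientGroup.mk (x i) : Gi i ⧸ Mi i)) = QuotientGroup.mk (eA.symm x))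
    (γi : ∀ i, Gi i) (hγi : ∀ i, ∀ m ∈ Mi i, m * γi i = γi i * m) (hγ : ∀ m ∈ M, m * eA.symm γi = eA.symm γi * m) (F : A → α) (p : ∀ i, Gi i ⧸ Mi i) :
    descConj (eA.symm γi) M hγ F (Ψ.symm p) = F (eA.symm fun i => descConj (γi i) (Mi i) (hγi i) id (p i)) := by
  have hp : p = fun i => (QuotientGroup.mk (p i).out : Gi i ⧸ Mi i) := funext fun i => (QuotientGroup.out_eq' (p i)).symm
  rw [hp, hΨsymm, descConj_mk, ← map_inv, ← map_mul, ← map_mul]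
  rfl

end Coord

end Literature.MeasureTheory.Group

end
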